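import Literature.AlgebraicGeometry.AbelianVarieties.MarkmanDescentTwistTranslate
import HarnessLib

/-!
# The descent twist `D′_s` under a translation `t_p` of `A × Â`, `p = (a, α)`:
# `t_p^*[D′_s] = [D′_s] · [N′_p]` with `N′_p = pr_A^*(P_{φ_Θ(a)}^{⊗2s} ⊗ P_α^{⊗j}) ⊗ pr_Â^*(P̂_a^{⊗j} ⊗ P̂_{φ_Θ⁻¹(α)}^{⊗(2s+1)})`, and `t_p^*D′_s ≅ D′_s ⊗ N′_p`

Layer `Literature/AlgebraicGeometry/AbelianVarieties`; sibling of `MarkmanDescentTwistTranslate` (the case `p = (1, α)`: `(1 × t_α)^*[D′_s] = [D′_s] · [N_α]`,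
`N_α = pr_A^*P_α^{⊗j} ⊗ pr_Â^*P̂_{φ⁻¹α}^{⊗(2s+1)}`). For a principally polarised complex abelian variety `(A, Θ)` and a complex point
`p = (a, α)` of `A × Â` acting by the translation `t_p` (`prodTranslation A Â p`; as a scheme automorphism `prodTranslationSchemeIso A Â p` of
`MarkmanPhiExchange` §0, `t_p = (t_a × 1) ≫ (1 × t_α)`):

* §1 the DISCREPANCY BUNDLE **`N′_p := pr_A^*(P_{φ_Θ(a)}^{⊗2s} ⊗ P_α^{⊗j}) ⊗ pr_Â^*(P̂_a^{⊗j} ⊗ P̂_{φ_Θ⁻¹(α)}^{⊗(2s+1)})`** (`descentTwistProdTranslate`; Pic⁰;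
  in Pic⁰ coordinates `Pic⁰(A) = Â`, `Pic⁰(Â) = A`: A-part `2s·φ_Θ(a) + j·α`, Â-part `j·a + (2s+1)·φ_Θ⁻¹(α)`) and its class along a `T`-valued point
  `h = (h₁, h₂)`: `2s•Λ(h₁, a_T) + j•Λ(h₁, (φ⁻¹α)_T) + j•Λ(a_T, h₂φ⁻¹) + (2s+1)•Λ((φ⁻¹α)_T, h₂φ⁻¹)`;
* §2 the CLASS IDENTITY along `T`-valued points **`[D′_s](h ≫ t_p) = [D′_s](h) + [N′_p](h)`** (`ofMul_pullback_prodTranslation_detClass_descentTwist`):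
  under `h ↦ h ≫ t_p`, `h₁ ↦ a_T·h₁` and `h₂φ⁻¹ ↦ (φ⁻¹α)_T·h₂φ⁻¹` (`prodTranslation_comp_fst∕snd`, `comp_translation_eq_mul`, `translation_comp_phiThetaInv`);
  expand `ofMul_pullback_detClass_descentTwist` by the biadditivity of Mumford's `Λ` (cubical structure) and `λ(xy) = Λ(x,y) + λ(x) + λ(y)`,
  `λ(c_T) = 0`, `Λ(c_T, c′_T) = 0`, `Λ(x⁻¹, y⁻¹) = Λ(x, y)`: the `Θ_sym^{⊗s}`-factor (type `2s`) moves by `2s•Λ(a_T, h₁)`, `𝒫^{⊗j}` by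
  `j•(Λ(a_T, h₂φ⁻¹) + Λ(h₁, (φ⁻¹α)_T))` (Lange 6.1.3), the `Â`-factor (type `2s+1`) by `(2s+1)•Λ((φ⁻¹α)_T, h₂φ⁻¹)`;
* §3 the identity in `Ȟ¹(A × Â, 𝒪^×)` **`t_p^*[D′_s] = [D′_s] · [N′_p]`** (`pullback_prodTranslation_detClass_descentTwist`, `T = A × Â`, `h = 𝟙`) and its MODULE FORM
  **`t_p^*D′_s ≅ D′_s ⊗ N′_p`** (`nonempty_pullback_prodTranslation_descentTwist_iso`, rank-one modules are classified by their class; a CHOSEN representative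
  `pullbackProdTranslationDescentTwistIso`).

This is identity (★) of the cell's E1 scoping memo (core-w5 g11; LEAD 169 + director-hodge g22 «GO (★)»): for the functor `Φ_T = Φ ⋙ (⊗ D′_s)⁺` it is the
Pic⁰ discrepancy by which `t_p^*` fails to commute with `⊗ D′_s`. Everything PROVED; 0 named facts; no instance, no notation. Typed for the cell `pub-hodge-ring2`
(crux 26512, socket v2's `e₁` input); a research route conditional on HC_CM, not a corollary — nothing in this file refers to it.

## References

* E. Markman, *Cycles on abelian 2n-folds of Weil type from secant sheaves on abelian n-folds*, arXiv:2502.03415 (2025), §9.3 Lemma 9.3.3 and Lemma 9.3.5,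
  p. 71 L44–70. [Markman2025SecantWeil]
* H. Lange, *Abelian Varieties over the Complex Numbers* (2023), §6.1.1 Lemma 6.1.3, §2.3. [Lange2023AbelianVarietiesComplex]
* D. Mumford, *Abelian Varieties* (1970), §6 Cor. 3–4, §8. [MumfordAV1970]
* R. Hartshorne, *Algebraic Geometry* (1977), II Ex. 6.8, III Ex. 4.5. [Hartshorne1977]
-/

noncomputable section

-- `TopCat.Presheaf`/`Scheme.Modules` are not reducible (as in Mathlib's `AlgebraicGeometry/Modules/Sheaf.lean`).
set_option backward.isDefEq.respectTransparency false

open CategoryTheory CategoryTheory.Limits AlgebraicGeometry MonoidalCategory CartesianMonoidalCategory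
open AlgebraicGeometry.Scheme.Modules

namespace Literature.AlgebraicGeometry.AbelianVarieties

open Literature.AlgebraicGeometry.Motives Literature.AlgebraicGeometry.Modules
open scoped MonObj

variable (A : AbelianVariety ℂ) {Θ : CartierDivisor A.X.left} (hΘ : Θ.IsAmple) (hK : A.KTheta Θ = ⊥)

/-! ### §0 Bookkeeping -/

section Bookkeeping

/-- `(f ≫ g)^* = f^* ∘ g^*` on `Ȟ¹(–, 𝒪^×)` (the tree's `CechPic.pullback_comp` of `Modules/UnitCocyclePresented`, outside this file's import
closure; re-proved privately as in `MarkmanKernelDescent`). [cite: Hartshorne1977, II Ex. 6.8 (functoriality of f^* on Pic)] -/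
private theorem cechPic_pullback_comp' {X Y Z : Scheme.{0}} (f : X ⟶ Y) (g : Y ⟶ Z) (c : CechPic Z) :
    CechPic.pullback (f ≫ g) c = CechPic.pullback f (CechPic.pullback g c) := by
  obtain ⟨c, rfl⟩ := CechPic.mk_surjective c
  rw [CechPic.pullback_mk, CechPic.pullback_mk, CechPic.pullback_mk]
  refine CechPic.sound (UnitCocycle.equiv_of_eq _ _
    (fun x => f ⁻¹ᵁ (g ⁻¹ᵁ c.U (g.base (f.base x)))) (fun x => c.mem (g.base (f.base x)))
    (fun x => le_of_eq rfl) (fun x => le_rfl) fun x y V hx hy => ?_)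
  change (g.appLE _ _ _ ≫ f.appLE _ V _) (c.g _ _ _ _ _) = (f ≫ g).appLE _ V _ (c.g _ _ _ _ _)
  rw [Scheme.Hom.appLE_comp_appLE]
  rfl

/-- `g ≫ toSpecOver S = toSpecOver T`. [cite: GortzWedhorn2023, Def./Rem. 27.1 (p. 799)] -/
private theorem comp_toSpecOver' {T S : SchemeOver ℂ} (g : T ⟶ S) : g ≫ toSpecOver S = toSpecOver T := by
  ext1
  rw [Over.comp_left, toSpecOver_left, toSpecOver_left, Over.w]

end Bookkeeping

/-! ### §1 The discrepancy bundle `N′_p` and its class along `T`-valued points -/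

section Discrepancy

variable (s j : ℕ) (p : (A.prod (A.dualOf Θ hΘ)).Points ℂ)

/-- **THE DISCREPANCY BUNDLE `N′_p := pr_A^*(P_{φ_Θ(a)}^{⊗2s} ⊗ P_α^{⊗j}) ⊗ pr_Â^*(P̂_a^{⊗j} ⊗ P̂_{φ_Θ⁻¹(α)}^{⊗(2s+1)})`** on `A × Â`, `p = (a, α)`
(`a = p ≫ pr₁`, `α = p ≫ pr₂`; `P_{φ_Θ(a)} = linePt (a ≫ φ_Θ)`, `P̂_x = linePtHat x`) — the Pic⁰ line bundle by which the descent twist `D′_s` moves under `t_p`.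
[cite: Markman2025SecantWeil, §9.3 Lemma 9.3.3 and Lemma 9.3.5 (p. 71)] [cite: Lange2023AbelianVarietiesComplex, §6.1.1 Lemma 6.1.3] -/
def descentTwistProdTranslate : (A.X ⊗ (A.dualOf Θ hΘ).X).left.Modules :=
  tensorObj
    ((Scheme.Modules.pullback (fst A.X (A.dualOf Θ hΘ).X).left).obj
      (tensorObj (tensorPow (linePt A hΘ hK ((p ≫ fst _ _) ≫ phiThetaOver A hΘ)) (2 * s)) (tensorPow (linePt A hΘ hK (p ≫ snd _ _)) j)))
    ((Scheme.Modules.pullback (snd A.X (A.dualOf Θ hΘ).X).left).obj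
      (tensorObj (tensorPow (linePtHat A hΘ hK (p ≫ fst _ _)) j)
        (tensorPow (linePtHat A hΘ hK ((p ≫ snd _ _) ≫ phiThetaInv A hΘ hK)) (2 * s + 1))))

/-- `N′_p` is finite locally free. [cite: StacksProject, Tag 01CA] -/
theorem isFiniteLocallyFree_descentTwistProdTranslate : IsFiniteLocallyFree (descentTwistProdTranslate A hΘ hK s j p) :=
  isFiniteLocallyFree_tensorObj _ _
    ((isFiniteLocallyFree_tensorObj _ _ (isFiniteLocallyFree_tensorPow (isFiniteLocallyFree_linePt A hΘ hK _) (2 * s))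
      (isFiniteLocallyFree_tensorPow (isFiniteLocallyFree_linePt A hΘ hK _) j)).pullback _)
    ((isFiniteLocallyFree_tensorObj _ _ (isFiniteLocallyFree_tensorPow (isFiniteLocallyFree_linePtHat A hΘ hK _) j)
      (isFiniteLocallyFree_tensorPow (isFiniteLocallyFree_linePtHat A hΘ hK _) (2 * s + 1))).pullback _)

/-- `N′_p` has rank one. [cite: StacksProject, Tag 01CA] -/
theorem hasRank_descentTwistProdTranslate : HasRank (descentTwistProdTranslate A hΘ hK s j p) 1 :=
  hasRank_tensorObj_one
    (hasRank_pullback _ (hasRank_tensorObj_one (hasRank_tensorPow_one (hasRank_linePt A hΘ hK _) (2 * s))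
      (hasRank_tensorPow_one (hasRank_linePt A hΘ hK _) j)))
    (hasRank_pullback _ (hasRank_tensorObj_one (hasRank_tensorPow_one (hasRank_linePtHat A hΘ hK _) j)
      (hasRank_tensorPow_one (hasRank_linePtHat A hΘ hK _) (2 * s + 1))))

variable {T : SchemeOver ℂ} [IsIntegral T.left]

/-- **The class of `N′_p` along a `T`-valued point `h = (h₁, h₂)` of `A × Â`:**
`2s•Λ(h₁, a_T) + j•Λ(h₁, (φ⁻¹α)_T) + (j•Λ(a_T, h₂φ⁻¹) + (2s+1)•Λ((φ⁻¹α)_T, h₂φ⁻¹))`. [cite: Lange2023AbelianVarietiesComplex, §6.1.1 Lemma 6.1.3]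
[cite: MumfordAV1970, §8 (the pairing Λ(L))] -/
theorem ofMul_pullback_detClass_descentTwistProdTranslate (h : T ⟶ A.X ⊗ (A.dualOf Θ hΘ).X) :
    Additive.ofMul (CechPic.pullback h.left (detClass (isFiniteLocallyFree_descentTwistProdTranslate A hΘ hK s j p))) =
      (2 * s) • AbelianVariety.Lam Θ (cechCl T.left) (h ≫ fst _ _) (toSpecOver T ≫ p ≫ fst _ _) +
        j • AbelianVariety.Lam Θ (cechCl T.left) (h ≫ fst _ _) (toSpecOver T ≫ (p ≫ snd _ _) ≫ phiThetaInv A hΘ hK) +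
      (j • AbelianVariety.Lam Θ (cechCl T.left) (toSpecOver T ≫ p ≫ fst _ _) (h ≫ snd _ _ ≫ phiThetaInv A hΘ hK) +
        (2 * s + 1) • AbelianVariety.Lam Θ (cechCl T.left) (toSpecOver T ≫ (p ≫ snd _ _) ≫ phiThetaInv A hΘ hK)
          (h ≫ snd _ _ ≫ phiThetaInv A hΘ hK)) := by
  have hP₁ := isFiniteLocallyFree_linePt A hΘ hK ((p ≫ fst _ _) ≫ phiThetaOver A hΘ)
  have hP₁r := hasRank_linePt A hΘ hK ((p ≫ fst _ _) ≫ phiThetaOver A hΘ)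
  have hP₂ := isFiniteLocallyFree_linePt A hΘ hK (p ≫ snd _ _)
  have hP₂r := hasRank_linePt A hΘ hK (p ≫ snd _ _)
  have hQ₁ := isFiniteLocallyFree_linePtHat A hΘ hK (p ≫ fst _ _)
  have hQ₁r := hasRank_linePtHat A hΘ hK (p ≫ fst _ _)
  have hQ₂ := isFiniteLocallyFree_linePtHat A hΘ hK ((p ≫ snd _ _) ≫ phiThetaInv A hΘ hK)
  have hQ₂r := hasRank_linePtHat A hΘ hK ((p ≫ snd _ _) ≫ phiThetaInv A hΘ hK)
  have hL := isFiniteLocallyFree_tensorObj _ _ (isFiniteLocallyFree_tensorPow hP₁ (2 * s)) (isFiniteLocallyFree_tensorPow hP₂ j)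
  have hLr := hasRank_tensorObj_one (hasRank_tensorPow_one hP₁r (2 * s)) (hasRank_tensorPow_one hP₂r j)
  have hM := isFiniteLocallyFree_tensorObj _ _ (isFiniteLocallyFree_tensorPow hQ₁ j) (isFiniteLocallyFree_tensorPow hQ₂ (2 * s + 1))
  have hMr := hasRank_tensorObj_one (hasRank_tensorPow_one hQ₁r j) (hasRank_tensorPow_one hQ₂r (2 * s + 1))
  rw [detClass_tensorObj_of_hasRank_one (hasRank_pullback _ hLr) (hasRank_pullback _ hMr) (hL.pullback _) (hM.pullback _)
      (isFiniteLocallyFree_descentTwistProdTranslate A hΘ hK s j p),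
    detClass_pullback _ hL, detClass_pullback _ hM,
    detClass_tensorObj_of_hasRank_one (hasRank_tensorPow_one hP₁r (2 * s)) (hasRank_tensorPow_one hP₂r j)
      (isFiniteLocallyFree_tensorPow hP₁ (2 * s)) (isFiniteLocallyFree_tensorPow hP₂ j) hL,
    detClass_tensorObj_of_hasRank_one (hasRank_tensorPow_one hQ₁r j) (hasRank_tensorPow_one hQ₂r (2 * s + 1))
      (isFiniteLocallyFree_tensorPow hQ₁ j) (isFiniteLocallyFree_tensorPow hQ₂ (2 * s + 1)) hM,
    detClass_tensorPow hP₁r hP₁, detClass_tensorPow hP₂r hP₂, detClass_tensorPow hQ₁r hQ₁, detClass_tensorPow hQ₂r hQ₂]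
  simp only [MonoidHom.map_mul, MonoidHom.map_pow, ofMul_mul, ofMul_pow]
  rw [← cechPic_pullback_comp', ← cechPic_pullback_comp', ← cechPic_pullback_comp', ← cechPic_pullback_comp', ← Over.comp_left,
    ← Over.comp_left, ofMul_pullback_detClass_linePt, ofMul_pullback_detClass_linePt, ofMul_pullback_detClass_linePtHat,
    ofMul_pullback_detClass_linePtHat]
  simp only [Category.assoc]
  rw [phiTheta_comp_phiThetaInv, Category.comp_id]

end Discrepancy

/-! ### §2 The class of `D′_s` along `h ≫ t_p` -/

section ClassIdentity

variable (s j : ℕ) (p : (A.prod (A.dualOf Θ hΘ)).Points ℂ) {T : SchemeOver ℂ} [IsIntegral T.left]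

/-- **THE CLASS IDENTITY along `T`-valued points: `[D′_s](h ≫ t_p) = [D′_s](h) + [N′_p](h)`** for every `h = (h₁, h₂) : T → A × Â` and every complex point
`p = (a, α)` of `A × Â`: under `h ↦ h ≫ t_p`, `h₁ ↦ a_T·h₁` and `h₂φ⁻¹ ↦ (φ⁻¹α)_T·h₂φ⁻¹`; expand by the biadditivity of `Λ` (the cubical structure),
`λ(xy) = Λ(x,y) + λ(x) + λ(y)`, `λ(c_T) = 0`, `Λ(c_T, c′_T) = 0`, `Λ(x⁻¹, y⁻¹) = Λ(x, y)`. [cite: Markman2025SecantWeil, §9.3 Lemma 9.3.3 p. 71 L54–70]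
[cite: Lange2023AbelianVarietiesComplex, §6.1.1 Lemma 6.1.3] [cite: MumfordAV1970, §6 Cor. 3–4 and §8] -/
theorem ofMul_pullback_prodTranslation_detClass_descentTwist (h : T ⟶ A.X ⊗ (A.dualOf Θ hΘ).X) :
    Additive.ofMul (CechPic.pullback (h ≫ prodTranslation A (A.dualOf Θ hΘ) p).left
        (detClass (isFiniteLocallyFree_descentTwist A hΘ hK s j))) =
      Additive.ofMul (CechPic.pullback h.left (detClass (isFiniteLocallyFree_descentTwist A hΘ hK s j))) +
        Additive.ofMul (CechPic.pullback h.left (detClass (isFiniteLocallyFree_descentTwistProdTranslate A hΘ hK s j p))) := by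
  have hadd := cechCl_add T.left
  have heq := linEquiv_iff_cechCl_eq T.left
  have hcube := A.cubicalStructure_linEquiv_holds
  -- the substitution `h ↦ h ≫ t_p`: `h₁ ↦ a_T · h₁`, `h₂ φ⁻¹ ↦ (φ⁻¹α)_T · (h₂ φ⁻¹)`
  have h₁ : (h ≫ prodTranslation A (A.dualOf Θ hΘ) p) ≫ fst _ _ = (toSpecOver T ≫ p ≫ fst _ _) * (h ≫ fst _ _) := by
    rw [Category.assoc, prodTranslation_comp_fst, ← Category.assoc, AbelianVariety.comp_translation_eq_mul]
  have h₂ : (h ≫ prodTranslation A (A.dualOf Θ hΘ) p) ≫ snd _ _ ≫ phiThetaInv A hΘ hK =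
      (toSpecOver T ≫ (p ≫ snd _ _) ≫ phiThetaInv A hΘ hK) * (h ≫ snd _ _ ≫ phiThetaInv A hΘ hK) := by
    rw [Category.assoc, ← Category.assoc (prodTranslation _ _ _) (snd _ _), prodTranslation_comp_snd, Category.assoc (snd _ _),
      translation_comp_phiThetaInv, ← Category.assoc (snd _ _), AbelianVariety.comp_translation_eq_mul, MonObj.comp_mul,
      ← Category.assoc h (toSpecOver _), comp_toSpecOver', Category.assoc]
  -- names for the atoms
  set a := toSpecOver T ≫ p ≫ fst _ _ with ha
  set c := toSpecOver T ≫ (p ≫ snd _ _) ≫ phiThetaInv A hΘ hK with hc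
  set y := h ≫ snd _ _ ≫ phiThetaInv A hΘ hK with hy
  set x := h ≫ fst _ _ with hx
  have hla : AbelianVariety.lam Θ (cechCl T.left) a = 0 := AbelianVariety.lam_toSpecOver_comp heq hadd _
  have hla' : AbelianVariety.lam Θ (cechCl T.left) a⁻¹ = 0 := by
    rw [ha, ← GrpObj.comp_inv]
    exact AbelianVariety.lam_toSpecOver_comp heq hadd _
  have hlc : AbelianVariety.lam Θ (cechCl T.left) c = 0 := AbelianVariety.lam_toSpecOver_comp heq hadd _
  have hlc' : AbelianVariety.lam Θ (cechCl T.left) c⁻¹ = 0 := by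
    rw [hc, ← GrpObj.comp_inv]
    exact AbelianVariety.lam_toSpecOver_comp heq hadd _
  have hac : AbelianVariety.Lam Θ (cechCl T.left) a c = 0 := by
    rw [ha, hc]
    exact Lam_const_const A _ _
  have hΛax : AbelianVariety.Lam Θ (cechCl T.left) a⁻¹ x⁻¹ = AbelianVariety.Lam Θ (cechCl T.left) a x := by
    rw [Lam_inv_left, Lam_inv_right, neg_neg]
  have hΛcy : AbelianVariety.Lam Θ (cechCl T.left) c⁻¹ y⁻¹ = AbelianVariety.Lam Θ (cechCl T.left) c y := by
    rw [Lam_inv_left, Lam_inv_right, neg_neg]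
  rw [ofMul_pullback_detClass_descentTwist, ofMul_pullback_detClass_descentTwist, ofMul_pullback_detClass_descentTwistProdTranslate,
    h₁, h₂, ← ha, ← hc, ← hy, ← hx, AbelianVariety.Lam_mul_left hadd heq hcube, AbelianVariety.Lam_mul_right hadd heq hcube,
    AbelianVariety.Lam_mul_right hadd heq hcube, mul_inv, mul_inv, lam_mul_eq, lam_mul_eq, lam_mul_eq, lam_mul_eq,
    hla, hla', hlc, hlc', hac, hΛax, hΛcy, AbelianVariety.Lam_comm x a]
  simp only [smul_add, add_smul, one_smul, two_mul, add_zero, zero_add]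
  abel

end ClassIdentity

/-! ### §3 The identity in `Ȟ¹(A × Â, 𝒪^×)` and its module form -/

section ModuleForm

variable (s j : ℕ) (p : (A.prod (A.dualOf Θ hΘ)).Points ℂ)

/-- **THE TRANSLATE IDENTITY IN `Ȟ¹`: `t_p^*[D′_s] = [D′_s] · [N′_p]`** for the descent twist `D′_s` and every complex point `p = (a, α)` of `A × Â` (the class
identity at `T = A × Â`, `h = 𝟙`; `t_p` is the scheme automorphism `prodTranslationSchemeIso A Â p`).
[cite: Markman2025SecantWeil, §9.3 Lemma 9.3.3 and Lemma 9.3.5 (p. 71)] [cite: Lange2023AbelianVarietiesComplex, §6.1.1 Lemma 6.1.3] -/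
theorem pullback_prodTranslation_detClass_descentTwist :
    CechPic.pullback (prodTranslationSchemeIso A (A.dualOf Θ hΘ) p).hom (detClass (isFiniteLocallyFree_descentTwist A hΘ hK s j)) =
      detClass (isFiniteLocallyFree_descentTwist A hΘ hK s j) *
        detClass (isFiniteLocallyFree_descentTwistProdTranslate A hΘ hK s j p) := by
  have h := ofMul_pullback_prodTranslation_detClass_descentTwist A hΘ hK s j p (𝟙 (A.X ⊗ (A.dualOf Θ hΘ).X))
  rw [Category.id_comp, Over.id_left, CechPic.pullback_id_apply, CechPic.pullback_id_apply, ← ofMul_mul] at h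
  exact Additive.ofMul.injective h

/-- **MODULE FORM: `t_p^*D′_s ≅ D′_s ⊗ N′_p`** with `N′_p` EXPLICIT (rank-one modules are classified by their class, `nonempty_iso_iff_detClass_eq`).
Objectwise; no normalisation of the isomorphism is asserted. [cite: Markman2025SecantWeil, §9.3 Lemma 9.3.3 and Lemma 9.3.5 (p. 71)] [cite: Hartshorne1977, III Ex. 4.5] -/
theorem nonempty_pullback_prodTranslation_descentTwist_iso :
    Nonempty ((Scheme.Modules.pullback (prodTranslationSchemeIso A (A.dualOf Θ hΘ) p).hom).obj (descentTwist A hΘ hK s j) ≅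
      tensorObj (descentTwist A hΘ hK s j) (descentTwistProdTranslate A hΘ hK s j p)) := by
  have hD := isFiniteLocallyFree_descentTwist A hΘ hK s j
  have hD₁ := hasRank_descentTwist A hΘ hK s j
  have hN := isFiniteLocallyFree_descentTwistProdTranslate A hΘ hK s j p
  have hN₁ := hasRank_descentTwistProdTranslate A hΘ hK s j p
  refine (nonempty_iso_iff_detClass_eq (hasRank_pullback _ hD₁) (hasRank_tensorObj_one hD₁ hN₁) (hD.pullback _)
    (isFiniteLocallyFree_tensorObj _ _ hD hN)).2 ?_
  rw [detClass_pullback _ hD, pullback_prodTranslation_detClass_descentTwist, detClass_tensorObj_of_hasRank_one hD₁ hN₁ hD hN]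

/-- A CHOSEN isomorphism `t_p^*D′_s ≅ D′_s ⊗ N′_p`. [cite: Markman2025SecantWeil, §9.3 Lemma 9.3.3 and Lemma 9.3.5 (p. 71)] -/
def pullbackProdTranslationDescentTwistIso :
    (Scheme.Modules.pullback (prodTranslationSchemeIso A (A.dualOf Θ hΘ) p).hom).obj (descentTwist A hΘ hK s j) ≅
      tensorObj (descentTwist A hΘ hK s j) (descentTwistProdTranslate A hΘ hK s j p) :=
  (nonempty_pullback_prodTranslation_descentTwist_iso A hΘ hK s j p).some

end ModuleForm

end Literature.AlgebraicGeometry.AbelianVarieties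

end
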